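import Summits.SmoothPoincare4.SmoothPoincare4.Theorems.EntropyRungSubcylindricalExistenceYamabeSobolev
import Summits.SmoothPoincare4.SmoothPoincare4.Theorems.EntropyRungSubcylindricalExistenceYamabeSobolevOfNonneg
import Summits.SmoothPoincare4.SmoothPoincare4.Theorems.EntropyRungSubcylindricalExistenceCoerciveSchrodingerSolve
import Literature.Geometry.Lorentzian.ConformalChangeFour
import Literature.Geometry.Riemannian.SchrodingerGroundState
import HarnessLib

/-!
# The Yamabe–Sobolev inequality of the capped class
(helpers `helper_cappedSobolev` (H-sob) and `helper_cappedSobolevUniform` of line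
`fat-conical-core-avr-logsobolev`, crux `EntropyRung.SubcylindricalExistence`,
item stmt-SmoothPoincare4-10871)

On a closed connected smooth `4`-manifold `M` of the summit binder let `g` be a smooth Riemannian
metric (Levi-Civita connection), `Φ > 0` smooth, and `G = Φ² g` a (Riemannian, Levi-Civita) metric
with `R_G ≥ 0` everywhere and `R_G > 0` somewhere. We prove that there is `Y > 0` with
`Y (∫ u⁴ Φ⁴ dV_g)^{1/2} ≤ ∫ (6 Φ² |∇u|²_g + R_G Φ⁴ u²) dV_g` for every smooth `u`
(`helper_cappedSobolev`), and more generally, uniformly over all smooth weights `ψ > 0`,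
`Y (∫ u⁴ ψ⁴ dV_g)^{1/2} ≤ ∫ (6 ψ² |∇u|²_g + ψ (R_g ψ − 6 Δ_g ψ) u²) dV_g`
(`helper_cappedSobolevUniform`).

Proof. By `stub_yamabeSobolevOfNonneg` it suffices to produce a smooth `u₀ > 0` with
`L_g u₀ := R_g u₀ − 6 Δ_g u₀ = 1` (Schoen's gauge); the weighted form with `ψ = Φ` is then the
capped form by the conformal law `R_G = Φ⁻³ L_g Φ` (`scalarCurvature_conformal_sq_four`).
The gauge `u₀` is `stub_coerciveSchrodingerSolve` for `V = R_g/6`, `h = 1/6`, once `−Δ_g + R_g/6`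
is coercive in `L²(dV_g)`. Coercivity: the ground state `φ > 0`, `−Δ_g φ + (R_g/6) φ = λ₁ φ` of
`exists_pos_groundState` bounds the Rayleigh quotient from below by `λ₁` on `C¹(M)`, and
`λ₁ > 0`: by Green's identity `6 λ₁ ∫ φ² = ∫ (6|∇φ|² + R_g φ²) dV_g`, which by the conformal
invariance of the Yamabe energy (`YamabeSobolev.integral_conformal_eq` with `φ = Φ v`) equals
`∫ (6 Φ² |∇v|²_g + R_G Φ⁴ v²) dV_g ≥ ∫ R_G Φ⁴ v² dV_g > 0` (`v > 0`, `R_G ≥ 0`, `R_G ≢ 0`, the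
Riemannian measure charges open sets). Everything is proved; no definition, no named fact.
References: Lee–Parker 1987, §3; Schoen 1984, §1; Aubin 1982, Ch. 6.
-/

noncomputable section

open scoped Manifold ContDiff Topology ENNReal NNReal
-- the registered namespace `Summit.SmoothPoincare4.SmoothPoincare4.Theorems` repeats a component
set_option linter.dupNamespace false
open Set Filter MeasureTheory
open Literature.Geometry.Lorentzian Literature.Geometry.Riemannian

namespace Summit.SmoothPoincare4.SmoothPoincare4.Theorems

namespace CappedSobolev

variable {M : Type} [TopologicalSpace M] [T2Space M]
  [ChartedSpace (EuclideanSpace ℝ (Fin 4)) M] [IsManifold (𝓡 4) ∞ M]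
  [CompactSpace M] [T3Space M] [MeasurableSpace M] [BorelSpace M]
  (g : PseudoRiemannianMetric (𝓡 4) ∞ (EuclideanSpace ℝ (Fin 4)) (TangentSpace (𝓡 4) : M → Type _))
  [g.HasLeviCivita]

omit [T2Space M] in
/-- **The Rayleigh quotient at an eigenfunction**: if `φ ∈ C^∞` solves `−Δ_g φ + V φ = λ φ` on the
closed manifold then `λ ∫ φ² dV_g = ∫ (|∇φ|²_g + V φ²) dV_g` (multiply by `φ`, integrate, Green's
first identity `∫ φ Δφ = −∫ |∇φ|²`). [folklore] -/
theorem eigenvalue_mul_integral_sq (hg : g.IsRiemannian) {φ V : M → ℝ} {ev : ℝ}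
    (hφ : ContMDiff (𝓡 4) 𝓘(ℝ, ℝ) ∞ φ) (hV : Continuous V)
    (heq : ∀ x, -g.dalembertian φ x + V x * φ x = ev * φ x) :
    ev * ∫ x, φ x ^ 2 ∂(riemannianMeasure (g.toContMDiffRiemannianMetric hg)) =
      ∫ x, (g.gradSq φ x + V x * φ x ^ 2)
        ∂(riemannianMeasure (g.toContMDiffRiemannianMetric hg)) := by
  set μ : Measure M := riemannianMeasure (g.toContMDiffRiemannianMetric hg) with hμ
  have hφ1 : ContMDiff (𝓡 4) 𝓘(ℝ, ℝ) 1 φ := hφ.of_le (by norm_num)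
  have hφ2 : ContMDiff (𝓡 4) 𝓘(ℝ, ℝ) 2 φ := hφ.of_le (WithTop.coe_le_coe.mpr le_top)
  -- Green's first identity `∫ φ Δφ = −∫ |∇φ|²`
  have hGreen : ∫ x, φ x * g.dalembertian φ x ∂μ = -∫ x, g.gradSq φ x ∂μ := by
    have h := integral_mul_dalembertian_riemVolume g hg hφ1 hφ2
    rw [PseudoRiemannianMetric.riemVolume_eq hg] at h
    exact h
  have hpt : ∀ x, ev * φ x ^ 2 = -(φ x * g.dalembertian φ x) + V x * φ x ^ 2 := fun x ↦ by
    calc ev * φ x ^ 2 = (ev * φ x) * φ x := by ring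
      _ = (-g.dalembertian φ x + V x * φ x) * φ x := by rw [heq x]
      _ = -(φ x * g.dalembertian φ x) + V x * φ x ^ 2 := by ring
  have hφc : Continuous φ := hφ.continuous
  have hΔc : Continuous (g.dalembertian φ) := continuous_dalembertian g hφ2
  have hGc : Continuous (g.gradSq φ) := (contMDiff_gradSq g hφ).continuous
  have i1 : Integrable (fun x ↦ φ x * g.dalembertian φ x) μ :=
    EntropyLocalisation.integrable_of_continuous g hg (hφc.mul hΔc)
  have i2 : Integrable (fun x ↦ V x * φ x ^ 2) μ :=
    EntropyLocalisation.integrable_of_continuous g hg (hV.mul (hφc.pow 2))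
  have i3 : Integrable (g.gradSq φ) μ := EntropyLocalisation.integrable_of_continuous g hg hGc
  have i1n : Integrable (fun x ↦ -(φ x * g.dalembertian φ x)) μ := i1.neg
  calc ev * ∫ x, φ x ^ 2 ∂μ = ∫ x, ev * φ x ^ 2 ∂μ := (integral_const_mul _ _).symm
    _ = ∫ x, (-(φ x * g.dalembertian φ x) + V x * φ x ^ 2) ∂μ :=
        integral_congr_ae (ae_of_all _ fun x ↦ hpt x)
    _ = -∫ x, φ x * g.dalembertian φ x ∂μ + ∫ x, V x * φ x ^ 2 ∂μ := by
        rw [integral_add i1n i2, integral_neg]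
    _ = ∫ x, g.gradSq φ x ∂μ + ∫ x, V x * φ x ^ 2 ∂μ := by rw [hGreen, neg_neg]
    _ = ∫ x, (g.gradSq φ x + V x * φ x ^ 2) ∂μ := (integral_add i3 i2).symm

/-- **Schoen's gauge for a class with a scalar-nonnegative, non-scalar-flat representative.**
If `G = Φ² g` (`Φ > 0` smooth) has `R_G ≥ 0`, `R_G ≢ 0` on the closed connected `4`-manifold, then
there is a smooth `u₀ > 0` with `R_g u₀ − 6 Δ_g u₀ = 1`: the operator `−Δ_g + R_g/6` is coercive
(its ground state eigenvalue `λ₁` satisfies `6λ₁ ∫φ² = ∫(6|∇φ|² + R_g φ²) dV_g =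
∫ (6Φ²|∇v|² + R_G Φ⁴ v²) dV_g > 0`, `φ = Φ v`, by the conformal invariance of the Yamabe energy),
hence positively invertible (`stub_coerciveSchrodingerSolve`). Lee–Parker 1987, §3; Schoen 1984,
§1. [folklore] -/
theorem exists_gauge [ConnectedSpace M] [SecondCountableTopology M] (hg : g.IsRiemannian)
    {Φ : M → ℝ}
    (G : PseudoRiemannianMetric (𝓡 4) ∞ (EuclideanSpace ℝ (Fin 4)) (TangentSpace (𝓡 4) : M → Type _))
    [G.HasLeviCivita] (hΦ : ContMDiff (𝓡 4) 𝓘(ℝ, ℝ) ∞ Φ) (hΦpos : ∀ x, 0 < Φ x)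
    (hconf : ∀ (x : M) (v w : TangentSpace (𝓡 4) x), G.val x v w = Φ x ^ 2 * g.val x v w)
    (hR0 : ∀ x, 0 ≤ G.scalarCurvature x) (hRpos : ∃ x, 0 < G.scalarCurvature x) :
    ∃ u₀ : M → ℝ, ContMDiff (𝓡 4) 𝓘(ℝ, ℝ) ∞ u₀ ∧ (∀ x, 0 < u₀ x) ∧
      ∀ x, g.scalarCurvature x * u₀ x - 6 * g.dalembertian u₀ x = 1 := by
  set μ : Measure M := riemannianMeasure (g.toContMDiffRiemannianMetric hg) with hμ
  haveI : μ.IsOpenPosMeasure := isOpenPosMeasure_riemannianMeasure _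
  have hΦne : ∀ x, Φ x ≠ 0 := fun x ↦ (hΦpos x).ne'
  -- the conformal law `R_G = Φ⁻³ (R_g Φ − 6 Δ_g Φ)`
  have hE : Module.finrank ℝ (EuclideanSpace ℝ (Fin 4)) = 4 := finrank_euclideanSpace_fin
  have hR : ∀ x, G.scalarCurvature x =
      (Φ x ^ 3)⁻¹ * (g.scalarCurvature x * Φ x - 6 * g.dalembertian Φ x) :=
    PseudoRiemannianMetric.scalarCurvature_conformal_sq_four hE g G hΦ hΦpos hconf
  have hL : ∀ x, Φ x * (g.scalarCurvature x * Φ x - 6 * g.dalembertian Φ x) =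
      G.scalarCurvature x * Φ x ^ 4 := fun x ↦ by
    rw [hR x]
    calc Φ x * (g.scalarCurvature x * Φ x - 6 * g.dalembertian Φ x)
        = (Φ x ^ 3)⁻¹ * Φ x ^ 3 * Φ x * (g.scalarCurvature x * Φ x - 6 * g.dalembertian Φ x) := by
          rw [inv_mul_cancel₀ (pow_ne_zero 3 (hΦne x)), one_mul]
      _ = _ := by ring
  -- the potential `V = R_g / 6` and its ground state
  set V : M → ℝ := fun x ↦ 6⁻¹ * g.scalarCurvature x with hV
  have hVs : ContMDiff (𝓡 4) 𝓘(ℝ, ℝ) ∞ V := contMDiff_const.mul g.contMDiff_scalarCurvature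
  obtain ⟨φ, ev, hφ, hφpos, heq, hRay⟩ := exists_pos_groundState g (by norm_num) hg hVs
  -- `λ₁ > 0`
  have hev : 0 < ev := by
    set v : M → ℝ := fun x ↦ (Φ x)⁻¹ * φ x with hv
    have hvs : ContMDiff (𝓡 4) 𝓘(ℝ, ℝ) ∞ v := (hΦ.inv₀ hΦne).mul hφ
    have hvpos : ∀ x, 0 < v x := fun x ↦ mul_pos (inv_pos.2 (hΦpos x)) (hφpos x)
    have hΦv : (fun y ↦ Φ y * v y) = φ := funext fun y ↦ mul_inv_cancel_left₀ (hΦne y) _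
    -- `6 λ₁ ∫ φ² = ∫ (6|∇φ|² + R φ²)`
    have h1 := eigenvalue_mul_integral_sq g hg hφ hVs.continuous heq
    -- conformal invariance of the Yamabe energy
    have h2 := YamabeSobolev.integral_conformal_eq g hg hΦ hvs
    rw [PseudoRiemannianMetric.riemVolume_eq hg, hΦv] at h2
    have hφc : Continuous φ := hφ.continuous
    have hRc : Continuous g.scalarCurvature := g.contMDiff_scalarCurvature.continuous
    have hRGc : Continuous G.scalarCurvature := G.contMDiff_scalarCurvature.continuous
    have hGφ : Continuous (g.gradSq φ) := (contMDiff_gradSq g hφ).continuous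
    have hGv : Continuous (g.gradSq v) := (contMDiff_gradSq g hvs).continuous
    have hvc : Continuous v := hvs.continuous
    have iG : Integrable (g.gradSq φ) μ := EntropyLocalisation.integrable_of_continuous g hg hGφ
    have iV : Integrable (fun x ↦ V x * φ x ^ 2) μ :=
      EntropyLocalisation.integrable_of_continuous g hg (hVs.continuous.mul (hφc.pow 2))
    -- the right-hand side of `h2` is `6 λ₁ ∫ φ²`
    have h3 : ∫ x, (6 * g.gradSq φ x + g.scalarCurvature x * (Φ x * v x) ^ 2) ∂μ =
        6 * (ev * ∫ x, φ x ^ 2 ∂μ) := by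
      rw [h1, ← integral_const_mul]
      refine integral_congr_ae (ae_of_all _ fun x ↦ ?_)
      show 6 * g.gradSq φ x + g.scalarCurvature x * (Φ x * v x) ^ 2 =
        6 * (g.gradSq φ x + V x * φ x ^ 2)
      rw [show Φ x * v x = φ x from congrFun hΦv x, hV]
      ring
    -- the left-hand side of `h2` is `≥ ∫ R_G Φ⁴ v² > 0`
    have hF : Continuous fun x ↦ G.scalarCurvature x * Φ x ^ 4 * v x ^ 2 :=
      (hRGc.mul (hΦ.continuous.pow 4)).mul (hvc.pow 2)
    have hFnn : 0 ≤ fun x ↦ G.scalarCurvature x * Φ x ^ 4 * v x ^ 2 := fun x ↦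
      mul_nonneg (mul_nonneg (hR0 x) (by positivity)) (sq_nonneg _)
    obtain ⟨x₀, hx₀⟩ := hRpos
    have hFx₀ : (fun x ↦ G.scalarCurvature x * Φ x ^ 4 * v x ^ 2) x₀ ≠ 0 := by
      dsimp only
      exact (mul_pos (mul_pos hx₀ (pow_pos (hΦpos x₀) 4)) (pow_pos (hvpos x₀) 2)).ne'
    have hpos : 0 < ∫ x, G.scalarCurvature x * Φ x ^ 4 * v x ^ 2 ∂μ :=
      integral_pos_of_integrable_nonneg_nonzero hF
        (EntropyLocalisation.integrable_of_continuous g hg hF) hFnn hFx₀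
    have iA : Integrable (fun x ↦ G.scalarCurvature x * Φ x ^ 4 * v x ^ 2) μ :=
      EntropyLocalisation.integrable_of_continuous g hg hF
    have iB : Integrable (fun x ↦ 6 * (Φ x ^ 2 * g.gradSq v x)
        + Φ x * (g.scalarCurvature x * Φ x - 6 * g.dalembertian Φ x) * v x ^ 2) μ := by
      refine EntropyLocalisation.integrable_of_continuous g hg ?_
      simp_rw [hL]
      exact (continuous_const.mul ((hΦ.continuous.pow 2).mul hGv)).add hF
    have hle : ∫ x, G.scalarCurvature x * Φ x ^ 4 * v x ^ 2 ∂μ ≤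
        ∫ x, (6 * (Φ x ^ 2 * g.gradSq v x)
          + Φ x * (g.scalarCurvature x * Φ x - 6 * g.dalembertian Φ x) * v x ^ 2) ∂μ := by
      refine integral_mono iA iB fun x ↦ ?_
      dsimp only
      rw [hL x]
      have : 0 ≤ 6 * (Φ x ^ 2 * g.gradSq v x) :=
        mul_nonneg (by norm_num) (mul_nonneg (sq_nonneg _) (g.innerDual_self_nonneg hg x _))
      linarith
    have h4 : 0 < 6 * (ev * ∫ x, φ x ^ 2 ∂μ) := by
      rw [← h3, ← h2]
      exact hpos.trans_le hle
    have hI : 0 ≤ ∫ x, φ x ^ 2 ∂μ := integral_nonneg fun x ↦ sq_nonneg _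
    by_contra hneg
    have : ev * ∫ x, φ x ^ 2 ∂μ ≤ 0 := mul_nonpos_of_nonpos_of_nonneg (not_lt.1 hneg) hI
    linarith
  -- the gauge: `−Δ u₀ + (R/6) u₀ = 1/6`
  obtain ⟨u₀, hu₀, hu₀pos, hu₀eq⟩ := stub_coerciveSchrodingerSolve M g hg V hVs ⟨ev, hev, hRay⟩
    (fun _ ↦ 6⁻¹) contMDiff_const (fun _ ↦ by norm_num)
  refine ⟨u₀, hu₀, hu₀pos, fun x ↦ ?_⟩
  have h6 : g.scalarCurvature x * u₀ x - 6 * g.dalembertian u₀ x =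
      6 * (-g.dalembertian u₀ x + V x * u₀ x) := by
    rw [hV]
    ring
  rw [h6, hu₀eq x]
  norm_num

end CappedSobolev

/-- **H-sob (uniform form) — the Yamabe–Sobolev inequality of the capped class, uniformly over
all smooth positive weights** (registered helper `helper_cappedSobolevUniform` of line
`fat-conical-core-avr-logsobolev`): if the conformal class of `g` on the closed connected
`4`-manifold contains `G = Φ² g` with `R_G ≥ 0`, `R_G ≢ 0`, then for some `Y > 0`, every smooth
`ψ > 0` and every smooth `u`,
`Y (∫ u⁴ ψ⁴ dV_g)^{1/2} ≤ ∫ (6 ψ² |∇u|²_g + ψ (R_g ψ − 6 Δ_g ψ) u²) dV_g`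
(`CappedSobolev.exists_gauge` and `stub_yamabeSobolevOfNonneg`). Lee–Parker 1987, §3;
Schoen 1984, §1. [folklore] -/
theorem helper_cappedSobolevUniform :
    ∀ (M : Type) [TopologicalSpace M] [T2Space M] [SecondCountableTopology M]
      [ChartedSpace (EuclideanSpace ℝ (Fin 4)) M] [IsManifold (𝓡 4) ∞ M] [CompactSpace M]
      [ConnectedSpace M] [T3Space M] [MeasurableSpace M] [BorelSpace M]
      (g : PseudoRiemannianMetric (𝓡 4) ∞ (EuclideanSpace ℝ (Fin 4)) (TangentSpace (𝓡 4) : M → Type _))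
      [g.HasLeviCivita] (hg : g.IsRiemannian) (Φ : M → ℝ)
      (G : PseudoRiemannianMetric (𝓡 4) ∞ (EuclideanSpace ℝ (Fin 4)) (TangentSpace (𝓡 4) : M → Type _))
      [G.HasLeviCivita], G.IsRiemannian →
      ContMDiff (𝓡 4) 𝓘(ℝ, ℝ) ∞ Φ → (∀ x, 0 < Φ x) →
      (∀ (x : M) (v w : TangentSpace (𝓡 4) x), G.val x v w = Φ x ^ 2 * g.val x v w) →
      (∀ x, 0 ≤ G.scalarCurvature x) → (∃ x, 0 < G.scalarCurvature x) →
      ∃ Y : ℝ, 0 < Y ∧ ∀ ψ : M → ℝ, ContMDiff (𝓡 4) 𝓘(ℝ, ℝ) ∞ ψ → (∀ x, 0 < ψ x) →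
        ∀ u : M → ℝ, ContMDiff (𝓡 4) 𝓘(ℝ, ℝ) ∞ u →
          Y * Real.sqrt (∫ x, u x ^ 4 * ψ x ^ 4 ∂(riemannianMeasure (g.toContMDiffRiemannianMetric hg))) ≤
            ∫ x, (6 * (ψ x ^ 2 * g.gradSq u x)
                + ψ x * (g.scalarCurvature x * ψ x - 6 * g.dalembertian ψ x) * u x ^ 2)
              ∂(riemannianMeasure (g.toContMDiffRiemannianMetric hg)) := by
  intro M _ _ _ _ _ _ _ _ _ _ g _ hg Φ G _ _ hΦ hΦpos hconf hR0 hRpos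
  exact stub_yamabeSobolevOfNonneg M g hg
    (CappedSobolev.exists_gauge g hg G hΦ hΦpos hconf hR0 hRpos)

/-- **H-sob — the Yamabe–Sobolev inequality of the capped class** (registered helper
`helper_cappedSobolev` of line `fat-conical-core-avr-logsobolev`): if `G = Φ² g` (`Φ > 0` smooth)
has `R_G ≥ 0`, `R_G ≢ 0` on the closed connected `4`-manifold, then for some `Y > 0` and every
smooth `u`, `Y (∫ u⁴ Φ⁴ dV_g)^{1/2} ≤ ∫ (6 Φ² |∇u|²_g + R_G Φ⁴ u²) dV_g`: the uniform form at the
weight `ψ = Φ`, rewritten with the conformal law `Φ (R_g Φ − 6 Δ_g Φ) = R_G Φ⁴`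
(`scalarCurvature_conformal_sq_four`). Lee–Parker 1987, §3; Aubin 1982, Ch. 6, §6.3. [folklore] -/
theorem helper_cappedSobolev :
    ∀ (M : Type) [TopologicalSpace M] [T2Space M] [SecondCountableTopology M]
      [ChartedSpace (EuclideanSpace ℝ (Fin 4)) M] [IsManifold (𝓡 4) ∞ M] [CompactSpace M]
      [ConnectedSpace M] [T3Space M] [MeasurableSpace M] [BorelSpace M]
      (g : PseudoRiemannianMetric (𝓡 4) ∞ (EuclideanSpace ℝ (Fin 4)) (TangentSpace (𝓡 4) : M → Type _))
      [g.HasLeviCivita] (hg : g.IsRiemannian) (Φ : M → ℝ)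
      (G : PseudoRiemannianMetric (𝓡 4) ∞ (EuclideanSpace ℝ (Fin 4)) (TangentSpace (𝓡 4) : M → Type _))
      [G.HasLeviCivita], G.IsRiemannian →
      ContMDiff (𝓡 4) 𝓘(ℝ, ℝ) ∞ Φ → (∀ x, 0 < Φ x) →
      (∀ (x : M) (v w : TangentSpace (𝓡 4) x), G.val x v w = Φ x ^ 2 * g.val x v w) →
      (∀ x, 0 ≤ G.scalarCurvature x) → (∃ x, 0 < G.scalarCurvature x) →
      ∃ Y : ℝ, 0 < Y ∧ ∀ u : M → ℝ, ContMDiff (𝓡 4) 𝓘(ℝ, ℝ) ∞ u →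
        Y * Real.sqrt (∫ x, u x ^ 4 * Φ x ^ 4 ∂(riemannianMeasure (g.toContMDiffRiemannianMetric hg))) ≤
          ∫ x, (6 * (Φ x ^ 2 * g.gradSq u x) + G.scalarCurvature x * Φ x ^ 4 * u x ^ 2)
            ∂(riemannianMeasure (g.toContMDiffRiemannianMetric hg)) := by
  intro M _ _ _ _ _ _ _ _ _ _ g _ hg Φ G _ hG hΦ hΦpos hconf hR0 hRpos
  obtain ⟨Y, hY, hYS⟩ :=
    helper_cappedSobolevUniform M g hg Φ G hG hΦ hΦpos hconf hR0 hRpos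
  -- the conformal law `Φ (R_g Φ − 6 Δ_g Φ) = R_G Φ⁴`
  have hE : Module.finrank ℝ (EuclideanSpace ℝ (Fin 4)) = 4 := finrank_euclideanSpace_fin
  have hR : ∀ x, G.scalarCurvature x =
      (Φ x ^ 3)⁻¹ * (g.scalarCurvature x * Φ x - 6 * g.dalembertian Φ x) :=
    PseudoRiemannianMetric.scalarCurvature_conformal_sq_four hE g G hΦ hΦpos hconf
  have hL : ∀ x, Φ x * (g.scalarCurvature x * Φ x - 6 * g.dalembertian Φ x) =
      G.scalarCurvature x * Φ x ^ 4 := fun x ↦ by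
    rw [hR x]
    calc Φ x * (g.scalarCurvature x * Φ x - 6 * g.dalembertian Φ x)
        = (Φ x ^ 3)⁻¹ * Φ x ^ 3 * Φ x * (g.scalarCurvature x * Φ x - 6 * g.dalembertian Φ x) := by
          rw [inv_mul_cancel₀ (pow_ne_zero 3 (hΦpos x).ne'), one_mul]
      _ = _ := by ring
  refine ⟨Y, hY, fun u hu ↦ (hYS Φ hΦ hΦpos u hu).trans_eq ?_⟩
  refine integral_congr_ae (ae_of_all _ fun x ↦ ?_)
  dsimp only
  rw [hL x]

end Summit.SmoothPoincare4.SmoothPoincare4.Theorems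

end
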